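import Summits.AtomisticToContinuum.Crystallization.Theorems.MinimiserShells.Negative.UniformRooting

/-!
# Negative knowledge for crux `MinimiserShells` (stmt-AtomisticToContinuum-9225) — ROOTEDNESS `0 ∈ S`
# IS FREE (standing disprover, gen 2)

The clause `0 ∈ S` of the hard-core hypothesis of `PalmUnimodularRigidity.MinimiserShells` is not
load-bearing: `minimiserShellsUnrooted_of_minimiserShells : MinimiserShells → (the crux with `0 ∈ S`
deleted)` (the converse is trivial).  Mechanism, all certified here and of independent use to provers:

* `countable_of_separated` — a `δ`-separated set (`δ > 0`) of `ℝ³` is countable, hence measurable;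
* `ae_root_or_eq_zero` — **Mecke forces the root**: under a point-stationary law a.s. carried by
  counting measures of separated sets, almost surely `0 ∈ S ∨ S = ∅` (transport
  `g(μ, y) = 1[μ{0} = 0]`: an unrooted configuration sends mass `1` to each of its points, nobody ever
  receives);
* `isPointStationaryLaw_restrict` — **conditioning on a re-rooting-invariant measurable event
  preserves point-stationarity** (the ergodic-component tool of every density argument);
* the proof: `S = ∅` with probability `1 − p ∈ (0, 1)` makes the conditioned law `p⁻¹ • P|{S ≠ ∅}`
  point-stationary, rooted, hard-core, with energy `E_P[h]/p < e*` (`e* < 0` is forced by the crux via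
  the lone root, `UniformRooting.not_minimiserShellsSlack_of_neg_eStar_le`), contradicting
  `e_uni ≥ e*`, which the crux implies (`HiddenDependency`);
* `meanRootEnergy_cond_le_of_minimising` — **the minimising face is closed under invariant
  conditioning**: given `e_uni ≥ e*` and `e* < 0`, conditioning a minimising point-stationary
  hard-core law on a re-rooting-invariant event of positive probability gives a minimising law (the
  "density zero ⇒ almost surely" / ergodic-component step of every line on the crux).

Supports item stmt-AtomisticToContinuum-9225; workfile `Cruxes/MinimiserShells/Disproof.lean` §7.
-/

noncomputable section

open MeasureTheory
open scoped ENNReal BigOperators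

namespace Summit.AtomisticToContinuum.Crystallization.Theorems.MinimiserShells.Negative.Rootedness

open Literature.Probability.Process
open Literature.MathematicalPhysics.StatisticalMechanics
open Literature.Geometry.DiscreteGeometry
open Summit.AtomisticToContinuum.Crystallization.Theses.PalmUnimodularRigidity
  (MinimiserShells UnimodularEnergyLowerBound)
open Summit.AtomisticToContinuum.Crystallization.Theorems.MinimiserShells.Negative.LoadBearing
  (eStar meanRootEnergy GoodShell minimiserShells_iff)
open Summit.AtomisticToContinuum.Crystallization.Theorems.MinimiserShells.Negative.UniformRooting
  (not_minimiserShellsSlack_of_neg_eStar_le minimiserShellsSlack_zero_iff)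
open Summit.AtomisticToContinuum.Crystallization.Theorems.MinimiserShells.Negative.HiddenDependency
  (not_minimiserShells_of_not_unimodularEnergyLowerBound)

/-- Euclidean 3-space. -/
abbrev E3 := EuclideanSpace ℝ (Fin 3)

/-! ## §7 Rootedness `0 ∈ S` is FREE

The clause `0 ∈ S` of hypothesis (i) can be deleted without changing the crux: the Mecke identity
with the transport `g(μ, y) = 1[μ{0} = 0]` ("an unrooted configuration sends mass `1` to each of its
points; nobody ever receives") forces `0 ∈ S ∨ S = ∅` almost surely, and `S = ∅` with positive
probability makes the conditioned law `P(· | S ≠ ∅)` — again point-stationary — STRICTLY sub-minimal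
(`E < e*`, as `e* < 0`), contradicting `e_uni ≥ e*`, which the crux itself implies (§3). -/

/-- Unrooted `δ`-hard-core configuration: `μ = count|S`, `S` `δ`-separated, root NOT required. -/
def IsHardCore (δ : ℝ) (μ : Measure E3) : Prop :=
  ∃ S : Set E3, (∀ x ∈ S, ∀ y ∈ S, x ≠ y → δ ≤ dist x y) ∧
    μ = (Measure.count : Measure E3).restrict S

/-- Forgetting the root. [folklore] -/
theorem IsRootedHardCore.isHardCore {δ : ℝ} {μ : Measure E3} (h : IsRootedHardCore δ μ) :
    IsHardCore δ μ := by
  obtain ⟨S, -, hsep, hμ⟩ := h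
  exact ⟨S, hsep, hμ⟩

/-- A `δ`-separated set (`δ > 0`) of `ℝ³` is countable (disjoint open balls in a separable space),
hence measurable. [folklore] -/
theorem countable_of_separated {δ : ℝ} (hδ : 0 < δ) {S : Set E3}
    (hsep : ∀ x ∈ S, ∀ y ∈ S, x ≠ y → δ ≤ dist x y) : S.Countable := by
  have hdisj : S.PairwiseDisjoint fun x => Metric.ball x (δ / 2) := by
    intro x hx y hy hxy
    change Disjoint (Metric.ball x (δ / 2)) (Metric.ball y (δ / 2))
    refine Set.disjoint_left.2 fun z hzx hzy => ?_
    have h1 : dist z x < δ / 2 := Metric.mem_ball.1 hzx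
    have h2 : dist z y < δ / 2 := Metric.mem_ball.1 hzy
    have h3 := hsep x hx y hy hxy
    linarith [dist_triangle_left x y z]
  exact hdisj.countable_of_isOpen (fun x _ => Metric.isOpen_ball)
    fun x _ => ⟨x, Metric.mem_ball_self (by linarith)⟩

/-- **Mecke forces the root.** Under a point-stationary law a.s. carried by counting measures of
separated sets, almost surely the origin is a point or the configuration is empty. [folklore] -/
theorem ae_root_or_eq_zero {δ : ℝ} (hδ : 0 < δ) {P : Measure (Measure E3)}
    (hcore : ∀ᵐ μ ∂P, IsHardCore δ μ) (hstat : IsPointStationaryLaw P) :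
    ∀ᵐ μ ∂P, μ {0} ≠ 0 ∨ μ = 0 := by
  classical
  set g : Measure E3 → E3 → ℝ≥0∞ := fun μ _ => if μ {0} = 0 then 1 else 0 with hg
  have hset : MeasurableSet {μ : Measure E3 | μ {0} = 0} :=
    (Measure.measurable_coe (measurableSet_singleton (0 : E3))) (measurableSet_singleton 0)
  have hgm : Measurable (Function.uncurry g) :=
    Measurable.ite (measurable_fst hset) measurable_const measurable_const
  have hM := hstat g hgm
  have hL : ∫⁻ μ, ∫⁻ y, g μ y ∂μ ∂P = ∫⁻ μ, (if μ {0} = 0 then 1 else 0) * μ Set.univ ∂P := by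
    refine lintegral_congr fun μ => ?_
    simp only [hg, lintegral_const]
  have hR : ∫⁻ μ, ∫⁻ y, g (Measure.map (fun z => z - y) μ) (-y) ∂μ ∂P = 0 := by
    have hae : ∀ᵐ μ ∂P, ∫⁻ y, g (Measure.map (fun z => z - y) μ) (-y) ∂μ = 0 := by
      refine hcore.mono fun μ hμ => ?_
      obtain ⟨S, hsep, rfl⟩ := hμ
      have hS : MeasurableSet S := (countable_of_separated hδ hsep).measurableSet
      refine (lintegral_congr_ae ((ae_restrict_iff' hS).2 (Filter.Eventually.of_forall
        fun y hy => ?_))).trans lintegral_zero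
      have h1 : (Measure.map (fun z => z - y) ((Measure.count : Measure E3).restrict S)) {0} ≠ 0 := by
        rw [Measure.map_apply (measurable_sub_const y) (measurableSet_singleton 0)]
        have hpre : (fun z : E3 => z - y) ⁻¹' ({0} : Set E3) = {y} := by
          ext z
          simp [sub_eq_zero]
        rw [hpre]
        exact (count_restrict_singleton_ne_zero_iff S y).2 hy
      simp only [hg, if_neg h1]
    rw [lintegral_congr_ae hae, lintegral_zero]
  rw [hL, hR] at hM
  have hmeas : Measurable fun μ : Measure E3 =>
      (if μ {0} = 0 then (1 : ℝ≥0∞) else 0) * μ Set.univ :=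
    (Measurable.ite hset measurable_const measurable_const).mul
      (Measure.measurable_coe MeasurableSet.univ)
  refine ((lintegral_eq_zero_iff hmeas).1 hM).mono fun μ hμ => ?_
  simp only [Pi.zero_apply, mul_eq_zero, ite_eq_right_iff, one_ne_zero, imp_false] at hμ
  rcases hμ with h | h
  · exact Or.inl h
  · exact Or.inr (Measure.measure_univ_eq_zero.1 h)

/-- **Conditioning on a re-rooting-invariant event preserves point-stationarity.** [folklore] -/
theorem isPointStationaryLaw_restrict {P : Measure (Measure E3)} (hP : IsPointStationaryLaw P)
    {A : Set (Measure E3)} (hA : MeasurableSet A)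
    (hinv : ∀ (μ : Measure E3) (y : E3), Measure.map (fun z => z - y) μ ∈ A ↔ μ ∈ A) :
    IsPointStationaryLaw (P.restrict A) := by
  classical
  intro g hg
  set c : Measure E3 → ℝ≥0∞ := A.indicator fun _ => 1 with hc
  have hcm : Measurable c := measurable_const.indicator hA
  have hc_top : ∀ μ, c μ ≠ ⊤ := fun μ => by
    by_cases hμ : μ ∈ A
    · rw [hc, Set.indicator_of_mem hμ]; exact ENNReal.one_ne_top
    · rw [hc, Set.indicator_of_notMem hμ]; exact ENNReal.zero_ne_top
  have hc_map : ∀ (μ : Measure E3) (y : E3), c (Measure.map (fun z => z - y) μ) = c μ := by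
    intro μ y
    by_cases hμ : μ ∈ A
    · rw [hc, Set.indicator_of_mem hμ, Set.indicator_of_mem ((hinv μ y).2 hμ)]
    · rw [hc, Set.indicator_of_notMem hμ, Set.indicator_of_notMem fun h => hμ ((hinv μ y).1 h)]
  have pull : ∀ F : Measure E3 → ℝ≥0∞, ∫⁻ μ in A, F μ ∂P = ∫⁻ μ, c μ * F μ ∂P := by
    intro F
    rw [← lintegral_indicator hA]
    refine lintegral_congr fun μ => ?_
    by_cases hμ : μ ∈ A
    · rw [Set.indicator_of_mem hμ, hc, Set.indicator_of_mem hμ, one_mul]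
    · rw [Set.indicator_of_notMem hμ, hc, Set.indicator_of_notMem hμ, zero_mul]
  have hg' : Measurable (Function.uncurry fun μ y => c μ * g μ y) :=
    (hcm.comp measurable_fst).mul hg
  rw [pull, pull]
  calc ∫⁻ μ, c μ * ∫⁻ y, g μ y ∂μ ∂P = ∫⁻ μ, ∫⁻ y, c μ * g μ y ∂μ ∂P := by
        refine lintegral_congr fun μ => ?_
        rw [lintegral_const_mul' _ _ (hc_top μ)]
    _ = ∫⁻ μ, ∫⁻ y, c (Measure.map (fun z => z - y) μ) *
          g (Measure.map (fun z => z - y) μ) (-y) ∂μ ∂P := hP _ hg'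
    _ = ∫⁻ μ, c μ * ∫⁻ y, g (Measure.map (fun z => z - y) μ) (-y) ∂μ ∂P := by
        refine lintegral_congr fun μ => ?_
        simp_rw [hc_map]
        rw [lintegral_const_mul' _ _ (hc_top μ)]

/-- READ-BACK of the support item 9229 (`Iff.rfl`). [folklore] -/
theorem unimodularEnergyLowerBound_iff :
    UnimodularEnergyLowerBound ↔ ∀ δ : ℝ, 0 < δ → ∀ P : Measure (Measure E3),
      IsProbabilityMeasure P → (∀ᵐ μ ∂P, IsRootedHardCore δ μ) → IsPointStationaryLaw P →
      eStar ≤ meanRootEnergy P :=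
  Iff.rfl

/-- **The crux implies its unrooted version** (so `0 ∈ S` is not load-bearing: any proof may
assume it, no proof needs it). [folklore] -/
theorem minimiserShellsUnrooted_of_minimiserShells (hMS : MinimiserShells) :
    ∀ δ : ℝ, 0 < δ → ∀ P : Measure (Measure E3), IsProbabilityMeasure P →
      (∀ᵐ μ ∂P, IsHardCore δ μ) → IsPointStationaryLaw P → meanRootEnergy P ≤ eStar →
      ∀ᵐ μ ∂P, GoodShell μ := by
  have hMS' := hMS
  rw [minimiserShells_iff] at hMS'
  have hU : UnimodularEnergyLowerBound := Classical.byContradiction fun hU =>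
    not_minimiserShells_of_not_unimodularEnergyLowerBound hU hMS
  rw [unimodularEnergyLowerBound_iff] at hU
  intro δ hδ P hP hcore hstat hE
  -- Step 0: `e* < 0` (else the lone root refutes the crux)
  have heneg : eStar < 0 := by
    by_contra h
    exact not_minimiserShellsSlack_of_neg_eStar_le (s := 0) (by linarith)
      (minimiserShellsSlack_zero_iff.2 hMS)
  -- Step 1: a.s. rooted or empty
  have hroot : ∀ᵐ μ ∂P, μ {0} ≠ 0 ∨ μ = 0 := ae_root_or_eq_zero hδ hcore hstat
  set A : Set (Measure E3) := {μ | μ Set.univ ≠ 0} with hA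
  have hAm : MeasurableSet A :=
    ((Measure.measurable_coe MeasurableSet.univ) (measurableSet_singleton (0 : ℝ≥0∞))).compl
  have hinv : ∀ (μ : Measure E3) (y : E3), Measure.map (fun z => z - y) μ ∈ A ↔ μ ∈ A := by
    intro μ y
    simp only [hA, Set.mem_setOf_eq, Measure.map_apply (measurable_sub_const y) MeasurableSet.univ,
      Set.preimage_univ]
  have hcoreA : ∀ᵐ μ ∂P, μ ∈ A → IsRootedHardCore δ μ := by
    filter_upwards [hcore, hroot] with μ hc hr hμA
    obtain ⟨S, hsep, rfl⟩ := hc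
    rcases hr with h0 | h0
    · exact ⟨S, (count_restrict_singleton_ne_zero_iff S 0).1 h0, hsep, rfl⟩
    · exfalso
      rw [h0] at hμA
      exact hμA (by simp)
  by_cases hfull : P Aᶜ = 0
  · have hmem : ∀ᵐ μ ∂P, μ ∈ A := by
      rw [ae_iff]
      exact hfull
    exact hMS' δ hδ P hP (by filter_upwards [hcoreA, hmem] with μ h1 h2 using h1 h2) hstat hE
  · exfalso
    set F : Measure E3 → ℝ := fun μ => (∫ y, lennardJones ‖y‖ ∂μ) / 2 with hF
    have hEdef : meanRootEnergy P = ∫ μ, F μ ∂P := rfl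
    have hint : Integrable F P := by
      by_contra hni
      rw [hEdef, integral_undef hni] at hE
      linarith
    have hFzero : ∀ μ ∈ Aᶜ, F μ = 0 := by
      intro μ hμ
      have hu : μ Set.univ = 0 := by
        simpa [hA] using hμ
      have : μ = 0 := Measure.measure_univ_eq_zero.1 hu
      simp [hF, this]
    have hsplit : ∫ μ, F μ ∂P = ∫ μ in A, F μ ∂P := by
      rw [← integral_add_compl hAm hint, setIntegral_eq_zero_of_forall_eq_zero hFzero, add_zero]
    have hpA0 : P A ≠ 0 := by
      intro h0
      have h1 : ∫ μ in A, F μ ∂P = 0 := by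
        rw [Measure.restrict_eq_zero.2 h0, integral_zero_measure]
      rw [hEdef, hsplit, h1] at hE
      linarith
    have hpA1 : P A < 1 := by
      by_contra hge
      have h1 : P A = 1 := le_antisymm prob_le_one (not_lt.1 hge)
      apply hfull
      rw [prob_compl_eq_one_sub hAm, h1, tsub_self]
    set p : ℝ≥0∞ := P A with hp
    have hp_top : p ≠ ⊤ := measure_ne_top P A
    set PA : Measure (Measure E3) := p⁻¹ • P.restrict A with hPA
    haveI : IsProbabilityMeasure PA := ⟨by
      rw [hPA, Measure.smul_apply, Measure.restrict_apply MeasurableSet.univ, Set.univ_inter,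
        smul_eq_mul, ENNReal.inv_mul_cancel hpA0 hp_top]⟩
    have hstatA : IsPointStationaryLaw PA := (isPointStationaryLaw_restrict hstat hAm hinv).smul _
    have hcorePA : ∀ᵐ μ ∂PA, IsRootedHardCore δ μ := by
      rw [hPA]
      refine Measure.ae_smul_measure ?_ _
      have h1 : ∀ᵐ μ ∂(P.restrict A), μ ∈ A := ae_restrict_mem hAm
      have h2 : ∀ᵐ μ ∂(P.restrict A), μ ∈ A → IsRootedHardCore δ μ := ae_restrict_of_ae hcoreA
      filter_upwards [h1, h2] with μ h1 h2 using h2 h1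
    have hEPA : meanRootEnergy PA = (p⁻¹).toReal * meanRootEnergy P := by
      rw [hEdef, hsplit, show meanRootEnergy PA = ∫ μ, F μ ∂PA from rfl, hPA, integral_smul_measure,
        smul_eq_mul]
    have hlow : eStar ≤ meanRootEnergy PA := hU δ hδ PA inferInstance hcorePA hstatA
    rw [hEPA, ENNReal.toReal_inv] at hlow
    have hpreal0 : 0 < p.toReal := ENNReal.toReal_pos hpA0 hp_top
    have hpreal1 : p.toReal < 1 := by
      have := (ENNReal.toReal_lt_toReal hp_top ENNReal.one_ne_top).2 hpA1
      rwa [ENNReal.toReal_one] at this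
    have hq1 : 1 < p.toReal⁻¹ := (one_lt_inv₀ hpreal0).2 hpreal1
    have h1 := mul_le_mul_of_nonneg_left hE (inv_pos.2 hpreal0).le
    have h2 := mul_pos (sub_pos.2 hq1) (neg_pos.2 heneg)
    nlinarith


/-- **The minimising face is closed under invariant conditioning.** Given `e_uni ≥ e*`
(`UnimodularEnergyLowerBound`, unfolded) and `e* < 0`: if `P` is a minimising point-stationary
`δ`-hard-core probability law and `A` a measurable re-rooting-invariant event with `P(A) > 0`, the
conditioned law `P(A)⁻¹ • P|A` (again point-stationary, `isPointStationaryLaw_restrict`, rooted and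
hard-core) is minimising too: `E_{P(·|A)}[h] ≤ e*`.  (Linearity: `E_P = P(A)·E_A + P(Aᶜ)·E_{Aᶜ}`, both
conditional energies are `≥ e*`.)  This is the "density zero ⇒ almost surely" / ergodic-component
step of every line on the crux and on `LayeredLawsSelectHcp`. [folklore] -/
theorem meanRootEnergy_cond_le_of_minimising (heneg : eStar < 0)
    (hU : ∀ δ : ℝ, 0 < δ → ∀ P : Measure (Measure E3), IsProbabilityMeasure P →
      (∀ᵐ μ ∂P, IsRootedHardCore δ μ) → IsPointStationaryLaw P → eStar ≤ meanRootEnergy P)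
    {δ : ℝ} (hδ : 0 < δ) (P : Measure (Measure E3)) [IsProbabilityMeasure P]
    (hcore : ∀ᵐ μ ∂P, IsRootedHardCore δ μ) (hstat : IsPointStationaryLaw P)
    (hE : meanRootEnergy P ≤ eStar) {A : Set (Measure E3)} (hA : MeasurableSet A)
    (hinv : ∀ (μ : Measure E3) (y : E3), Measure.map (fun z => z - y) μ ∈ A ↔ μ ∈ A)
    (hpA : P A ≠ 0) :
    meanRootEnergy ((P A)⁻¹ • P.restrict A) ≤ eStar := by
  set F : Measure E3 → ℝ := fun μ => (∫ y, lennardJones ‖y‖ ∂μ) / 2 with hF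
  have hEdef : ∀ Q : Measure (Measure E3), meanRootEnergy Q = ∫ μ, F μ ∂Q := fun Q => rfl
  have hint : Integrable F P := by
    by_contra hni
    rw [hEdef, integral_undef hni] at hE
    linarith
  have hsplit : ∫ μ, F μ ∂P = (∫ μ in A, F μ ∂P) + ∫ μ in Aᶜ, F μ ∂P :=
    (integral_add_compl hA hint).symm
  -- the conditioned law on a measurable invariant event `B` of positive probability
  have cond : ∀ (B : Set (Measure E3)), MeasurableSet B →
      (∀ (μ : Measure E3) (y : E3), Measure.map (fun z => z - y) μ ∈ B ↔ μ ∈ B) → P B ≠ 0 →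
      (P B).toReal * eStar ≤ ∫ μ in B, F μ ∂P ∧
        meanRootEnergy ((P B)⁻¹ • P.restrict B) = (P B).toReal⁻¹ * ∫ μ in B, F μ ∂P := by
    intro B hB hinvB hpB
    have hp_top : P B ≠ ⊤ := measure_ne_top P B
    set PB : Measure (Measure E3) := (P B)⁻¹ • P.restrict B with hPB
    haveI : IsProbabilityMeasure PB := ⟨by
      rw [hPB, Measure.smul_apply, Measure.restrict_apply MeasurableSet.univ, Set.univ_inter,
        smul_eq_mul, ENNReal.inv_mul_cancel hpB hp_top]⟩
    have hstatB : IsPointStationaryLaw PB := (isPointStationaryLaw_restrict hstat hB hinvB).smul _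
    have hcoreB : ∀ᵐ μ ∂PB, IsRootedHardCore δ μ := by
      rw [hPB]
      exact Measure.ae_smul_measure (ae_restrict_of_ae hcore) _
    have hEB : meanRootEnergy PB = (P B).toReal⁻¹ * ∫ μ in B, F μ ∂P := by
      rw [hEdef, hPB, integral_smul_measure, smul_eq_mul, ENNReal.toReal_inv]
    have hlow : eStar ≤ meanRootEnergy PB := hU δ hδ PB inferInstance hcoreB hstatB
    refine ⟨?_, hEB⟩
    rw [hEB] at hlow
    have hpos : 0 < (P B).toReal := ENNReal.toReal_pos hpB hp_top
    calc (P B).toReal * eStar ≤ (P B).toReal * ((P B).toReal⁻¹ * ∫ μ in B, F μ ∂P) :=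
          mul_le_mul_of_nonneg_left hlow hpos.le
      _ = ∫ μ in B, F μ ∂P := by rw [← mul_assoc, mul_inv_cancel₀ hpos.ne', one_mul]
  obtain ⟨hAlow, hEA⟩ := cond A hA hinv hpA
  have hposA : 0 < (P A).toReal := ENNReal.toReal_pos hpA (measure_ne_top P A)
  rw [hEA]
  -- it remains to see `∫_A F ≤ P(A)·e*`
  suffices hmain : ∫ μ in A, F μ ∂P ≤ (P A).toReal * eStar by
    calc (P A).toReal⁻¹ * ∫ μ in A, F μ ∂P ≤ (P A).toReal⁻¹ * ((P A).toReal * eStar) :=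
          mul_le_mul_of_nonneg_left hmain (inv_pos.2 hposA).le
      _ = eStar := by rw [← mul_assoc, inv_mul_cancel₀ hposA.ne', one_mul]
  have hsum : (P A).toReal + (P Aᶜ).toReal = 1 := by
    rw [← ENNReal.toReal_add (measure_ne_top P A) (measure_ne_top P Aᶜ),
      measure_add_measure_compl hA, measure_univ, ENNReal.toReal_one]
  by_cases hqA : P Aᶜ = 0
  · have h0 : ∫ μ in Aᶜ, F μ ∂P = 0 := by
      rw [Measure.restrict_eq_zero.2 hqA, integral_zero_measure]
    have h1 : (P A).toReal = 1 := by
      rw [hqA, ENNReal.toReal_zero, add_zero] at hsum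
      exact hsum
    have h2 : ∫ μ in A, F μ ∂P = meanRootEnergy P := by
      rw [hEdef, hsplit, h0, add_zero]
    rw [h1, one_mul, h2]
    exact hE
  · have hinvc : ∀ (μ : Measure E3) (y : E3), Measure.map (fun z => z - y) μ ∈ Aᶜ ↔ μ ∈ Aᶜ :=
      fun μ y => not_congr (hinv μ y)
    obtain ⟨hAclow, -⟩ := cond Aᶜ hA.compl hinvc hqA
    have hEP : ∫ μ, F μ ∂P ≤ eStar := by rw [← hEdef]; exact hE
    rw [hsplit] at hEP
    nlinarith


end Summit.AtomisticToContinuum.Crystallization.Theorems.MinimiserShells.Negative.Rootedness
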